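import Mathlib.Algebra.Order.BigOperators.Group.Finset
import Mathlib.Data.Nat.Log
import Mathlib.Tactic.NormNum
import Mathlib.Tactic.Ring
import Mathlib.Tactic.Linarith
import Summits.ValiantsHypothesis.ValiantsHypothesis.Theses.DetQP

/-!
# `DetqpThesis` (stmt-ValiantsHypothesis-0315) — negative-side tools: the shape of `¬ IsQPBounded`

Crux work file `Cruxes/DetqpThesis/Disproof.lean` §(R)/(E), landed for import by provers and
planners.  The crux `X = ¬ IsQPBounded (n ↦ dc(per_n))` has no hypotheses; what can be said
unconditionally about its SHAPE is arithmetic of the template `2^{(log₂ n + c)^c}`: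

* `qpBound_mono` — the template is monotone in `c`;
* `isQPBounded_of_eventually` — `IsQPBounded` absorbs finitely many values, so
  `not_isQPBounded_iff_frequently`: `¬ IsQPBounded t ↔ ∀ c n₀, ∃ n ≥ n₀, 2^{(log₂ n+c)^c} < t n`
  (the crux is an infinitely-often statement; degenerate small `n` can never decide it);
* `exists_ge_qpExp_le` — the explicit gap point `n = 2^(2^j - c)`, `j = 2c + 2 + n₀`, where
  `(log₂ n + c)^c ≤ n - 1`;
* `not_isQPBounded_of_eventually_ge` — an eventual lower bound `2^n - 1 ≤ t n` gives
  `¬ IsQPBounded t`: the lemma through which "Grenet is optimal for large `n`"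
  (GrenetRigidity-type cruxes) or the LR17 equivariant bound would yield `X`;
  `not_isQPBounded_two_pow_sub_one`; and the general transfer
  `not_isQPBounded_of_eventually_le` (`g` not qp-bounded, `g ≤ t` eventually ⇒ `t` not qp-bounded)
  — the exact shape in which any eventual lower bound on `dc(per_n)` proves the crux.
[folklore]
-/

namespace Summit.ValiantsHypothesis.Theorems.DetqpThesis.Negative

open Summit.ValiantsHypothesis.ValiantsHypothesis.Theses (DetQP.DetqpThesis)

open Literature.Computability.AlgebraicComplexity

/-- The qp template `2^{(log₂ n + c)^c}` is monotone in the constant `c`. [folklore] -/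
theorem qpBound_mono {c c' : ℕ} (h : c ≤ c') (n : ℕ) :
    2 ^ ((Nat.log 2 n + c) ^ c) ≤ 2 ^ ((Nat.log 2 n + c') ^ c') := by
  apply Nat.pow_le_pow_right (by norm_num)
  rcases Nat.eq_zero_or_pos (Nat.log 2 n + c') with h0 | hpos
  · have hc' : c' = 0 := by omega
    have hc : c = 0 := by omega
    subst hc' hc
    exact le_rfl
  · calc (Nat.log 2 n + c) ^ c ≤ (Nat.log 2 n + c') ^ c := Nat.pow_le_pow_left (by omega) _
      _ ≤ (Nat.log 2 n + c') ^ c' := Nat.pow_le_pow_right hpos h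

/-- `IsQPBounded` is insensitive to finitely many values: an eventual qp bound is a qp bound
(enlarge the constant by the sum of the finitely many exceptional values, plus one). [folklore] -/
theorem isQPBounded_of_eventually {t : ℕ → ℕ}
    (h : ∃ c n₀ : ℕ, ∀ n ≥ n₀, t n ≤ 2 ^ ((Nat.log 2 n + c) ^ c)) : IsQPBounded t := by
  obtain ⟨c, n₀, h⟩ := h
  refine ⟨c + (∑ i ∈ Finset.range n₀, t i) + 1, fun n => ?_⟩
  set M := ∑ i ∈ Finset.range n₀, t i with hM
  rcases Nat.lt_or_ge n n₀ with hn | hn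
  · have h1 : t n ≤ M :=
      Finset.single_le_sum (f := t) (fun _ _ => Nat.zero_le _) (Finset.mem_range.2 hn)
    calc t n ≤ M := h1
      _ ≤ 2 ^ M := (Nat.lt_two_pow_self).le
      _ ≤ 2 ^ ((Nat.log 2 n + (c + M + 1)) ^ (c + M + 1)) := by
        apply Nat.pow_le_pow_right (by norm_num)
        calc M ≤ (Nat.log 2 n + (c + M + 1)) ^ 1 := by rw [pow_one]; omega
          _ ≤ (Nat.log 2 n + (c + M + 1)) ^ (c + M + 1) :=
            Nat.pow_le_pow_right (by omega) (by omega)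
  · exact (h n hn).trans (qpBound_mono (by omega) n)

/-- `¬ IsQPBounded t` in "infinitely often" form: every template constant is violated at
arbitrarily large arguments. [folklore] -/
theorem not_isQPBounded_iff_frequently {t : ℕ → ℕ} :
    ¬ IsQPBounded t ↔ ∀ c n₀ : ℕ, ∃ n ≥ n₀, 2 ^ ((Nat.log 2 n + c) ^ c) < t n := by
  constructor
  · intro h c n₀
    by_contra hcon
    simp only [not_exists, not_and, not_lt] at hcon
    exact h (isQPBounded_of_eventually ⟨c, n₀, fun n hn => hcon n hn⟩)
  · rintro h ⟨c, hc⟩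
    obtain ⟨n, -, hn⟩ := h c 0
    exact absurd (hc n) (not_le.mpr hn)

/-- The crux in "infinitely often" form. [folklore] -/
theorem detqpThesis_iff_frequently :
    DetQP.DetqpThesis ↔ ∀ c n₀ : ℕ, ∃ n ≥ n₀,
      2 ^ ((Nat.log 2 n + c) ^ c) < determinantalComplexity (perPoly (Fin n) ℂ) :=
  not_isQPBounded_iff_frequently

/-- Linear-versus-exponential: `c · (2c + 3 + i) < 2^{2c + 2 + i}`. [folklore] -/
theorem mul_lt_two_pow_aux (c i : ℕ) : c * (2 * c + 2 + i + 1) < 2 ^ (2 * c + 2 + i) := by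
  have hc : c < 2 ^ c := Nat.lt_two_pow_self
  have hj : 2 * c + 2 + i + 1 ≤ 2 ^ (c + 2 + i) := by
    have := @Nat.lt_two_pow_self (c + 1 + i)
    have : 2 ^ (c + 2 + i) = 2 * 2 ^ (c + 1 + i) := by
      rw [← pow_succ']; congr 1; omega
    omega
  calc c * (2 * c + 2 + i + 1) ≤ c * 2 ^ (c + 2 + i) := Nat.mul_le_mul (le_refl c) hj
    _ < 2 ^ c * 2 ^ (c + 2 + i) := Nat.mul_lt_mul_of_pos_right hc (Nat.two_pow_pos _)
    _ = 2 ^ (2 * c + 2 + i) := by rw [← pow_add]; congr 1; omega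

/-- **The explicit gap point.** For every template constant `c` and every `n₀` there is `n ≥ n₀`
(namely `n = 2^(2^j - c)` with `j = 2c + 2 + n₀`) with `(log₂ n + c)^c ≤ n - 1`, whence
`2^{(log₂ n + c)^c} ≤ 2^{n-1} < 2^n - 1`. [folklore] -/
theorem exists_ge_qpExp_le (c n₀ : ℕ) :
    ∃ n, n₀ ≤ n ∧ 2 ≤ n ∧ (Nat.log 2 n + c) ^ c ≤ n - 1 := by
  set j := 2 * c + 2 + n₀ with hj
  have h2j : j < 2 ^ j := Nat.lt_two_pow_self
  set L := 2 ^ j - c with hL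
  have hLc : L + c = 2 ^ j := by omega
  have hL1 : n₀ + 1 ≤ L := by omega
  have h2L : L < 2 ^ L := Nat.lt_two_pow_self
  refine ⟨2 ^ L, by omega, ?_, ?_⟩
  · calc 2 = 2 ^ 1 := rfl
      _ ≤ 2 ^ L := Nat.pow_le_pow_right (by norm_num) (by omega)
  · rw [Nat.log_pow Nat.one_lt_two, hLc, ← pow_mul]
    have hjc : j * c < L := by
      have := mul_lt_two_pow_aux c n₀
      have : j * c + c < 2 ^ j := by rw [hj]; nlinarith
      omega
    have h1 : 2 ^ (j * c) ≤ 2 ^ (L - 1) := Nat.pow_le_pow_right (by norm_num) (by omega)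
    have h2 : 2 ^ L = 2 * 2 ^ (L - 1) := by rw [← pow_succ']; congr 1; omega
    have h3 : 1 ≤ 2 ^ (L - 1) := Nat.one_le_two_pow
    omega

/-- **Exponential lower bounds eventually ⇒ not qp-bounded.** If `2^n - 1 ≤ t n` for all large `n`
then `t` is not quasi-polynomially bounded. [folklore] -/
theorem not_isQPBounded_of_eventually_ge {t : ℕ → ℕ}
    (h : ∃ n₀, ∀ n ≥ n₀, 2 ^ n - 1 ≤ t n) : ¬ IsQPBounded t := by
  rintro ⟨c, hc⟩
  obtain ⟨n₀, h⟩ := h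
  obtain ⟨n, hn₀, hn2, hexp⟩ := exists_ge_qpExp_le c n₀
  have h1 : 2 ^ ((Nat.log 2 n + c) ^ c) ≤ 2 ^ (n - 1) := Nat.pow_le_pow_right (by norm_num) hexp
  have h2 : 2 ^ n = 2 * 2 ^ (n - 1) := by rw [← pow_succ']; congr 1; omega
  have h3 : 2 ≤ 2 ^ (n - 1) := by
    calc 2 = 2 ^ 1 := rfl
      _ ≤ 2 ^ (n - 1) := Nat.pow_le_pow_right (by norm_num) (by omega)
  have h4 := h n hn₀
  have h5 := hc n
  omega


/-- **Transfer of non-qp-boundedness along an eventual comparison**: if `g` is not qp-bounded and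
`g n ≤ t n` for all large `n`, then `t` is not qp-bounded (`IsQPBounded` absorbs the finitely many
small `n`).  This is the form in which ANY eventual lower bound `g ≤ dc(per_·)` with `g` beyond
quasi-polynomial proves the crux. [folklore] -/
theorem not_isQPBounded_of_eventually_le {g t : ℕ → ℕ} (hg : ¬ IsQPBounded g)
    (h : ∃ n₀, ∀ n ≥ n₀, g n ≤ t n) : ¬ IsQPBounded t := by
  rintro ⟨c, hc⟩
  obtain ⟨n₀, h⟩ := h
  exact hg (isQPBounded_of_eventually ⟨c, n₀, fun n hn => (h n hn).trans (hc n)⟩)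

/-- Grenet's function `2^n - 1` is not quasi-polynomially bounded. [folklore] -/
theorem not_isQPBounded_two_pow_sub_one : ¬ IsQPBounded fun n => 2 ^ n - 1 :=
  not_isQPBounded_of_eventually_ge ⟨0, fun _ _ => le_rfl⟩

end Summit.ValiantsHypothesis.Theorems.DetqpThesis.Negative
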